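import Literature.AlgebraicGeometry.Modules.GrothendieckComplexOfProper
import Literature.Algebra.Homology.HmkQExtendScalarsBaseChangeComplex
import Literature.Algebra.Homology.HOneMkQOfQuasiIso
import HarnessLib

/-!
# Cohomology counts of the Grothendieck complex after an affine base change are those of the Čech complex of the pulled-back bundle
# ([MumfordAV1970] §5 Lemma 2 and Cor. 2; [GortzWedhorn2023] Prop. 22.90, Cor. 23.135)

Layer `Literature/AlgebraicGeometry/Modules`, namespace `Literature.AlgebraicGeometry.Modules`.  THEOREMS ONLY (no definition, no named fact,
no instance, no notation, no `sorry`), over ★ `GrothendieckComplexOfProper` (§1 the strictly perfect model `K• ⥲ Č•(𝓤, G)` of a vector bundle on a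
proper flat `g : X → B` over an affine noetherian base; §2 the affine base change `Č•(𝓤, G) ⊗_{Γ(B)} Γ(B') ≅ Č•(k⁻¹𝓤, k^*G)` along a cartesian square),
★ `FlatQuasiIsoBaseChange.quasiIso_extendScalars_map_of_flat` (Mumford §5 Lemma 2: base change of a quasi-isomorphism of bounded above flat complexes),
★ `HOneMkQOfQuasiIso` (the map-`mkQ` cohomology is a quasi-iso invariant) and ★ `HmkQExtendScalarsBaseChangeComplex` (`extendScalars` ↔ `baseChangeComplex`).
Cell `hodgecm-mathlib` (D-0151), junction (J10-iii-a) of the «H1-DIM-ANY-CHAR cut» (B-p04 memo v3 §2): in the proof of `dim H¹(A, 𝒪_A) = g`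
(Mumford §13 Cor. 2) the entry point ★ `finrank_HOne_baseChangeComplex_residueField_eq_finrank_cotangentSpace` computes
`finrank_k H¹(k ⊗ K•)` for the Grothendieck complex `K•` of the Poincaré bundle, and this file turns that number into the `H¹` count of the Čech
complex of the RESTRICTED bundle on the fibre — for ANY flat model `K• ⥲ Č•(𝓤, G)` and any affine base change `j : B' → B`.

* **`finrank_HmkQ_baseChangeComplex_eq_of_isPullback`** — for a cartesian square `k : X' → X`, `g' : X' → B'` over `g : X → B` FLAT, `j : B' → B` with
  `B, B'` affine, a finite cover `𝓤` of `X` with affine non-empty finite intersections, `G` finite locally free, and a quasi-isomorphism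
  `ψ : K• → Č•(𝓤, G)` from a bounded above complex of flat `Γ(B)`-modules: for all degrees `a + 1 = b`, `b + 1 = c`,
  `finrank_{Γ(B')} H^b_mkQ(baseChangeComplex Γ(B') K•) = finrank_{Γ(B')} H^b_mkQ(Č•(k⁻¹𝓤, k^*G))` (algebra structure `(j.appLE ⊤ ⊤ _).toAlgebra`);
* `nonempty_HmkQ_baseChangeComplex_linearEquiv_of_isPullback` — the underlying `Γ(B')`-linear isomorphism.

HC_CM is proved only modulo the 7 printed citations until rung 0 closes; nothing here bears on a summit statement (count-neutral capital).

## References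
* [MumfordAV1970] D. Mumford, *Abelian Varieties* (1970), §5 Lemma 2 (p. 49) and Cor. 2 (p. 50–51).
* [GortzWedhorn2023] U. Görtz, T. Wedhorn, *Algebraic Geometry II* (2023), Prop. 22.90 (p. 277), Cor. 23.135 (p. 355).
-/

set_option autoImplicit false

open CategoryTheory CategoryTheory.Limits Opposite TopologicalSpace AlgebraicGeometry TensorProduct
open Literature.Algebra.Homology

noncomputable section

namespace Literature.AlgebraicGeometry.Modules

open Literature.AlgebraicGeometry.Morphisms Literature.AlgebraicGeometry.HodgeTheory Literature.AlgebraicGeometry.Motives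

variable {X B X' B' : Scheme.{0}} {g : X ⟶ B} {g' : X' ⟶ B'} {k : X' ⟶ X} {j : B' ⟶ B}
  [IsAffine B] [IsAffine B'] (H : IsPullback k g' g j) [Flat g]
  {ι : Type} [LinearOrder ι] [Fintype ι] (U : ι → X.Opens)
  (hUa : ∀ s : Finset ι, s.Nonempty → IsAffineOpen (cechOpen U s)) {G : X.Modules} (hL : IsFiniteLocallyFree G)
  {K : CochainComplex (ModuleCat.{0} Γ(B, ⊤)) ℤ} (ψ : K ⟶ cechComplex U G g.appTop.hom) [QuasiIso ψ]
  (hK : ∀ n, Module.Flat Γ(B, ⊤) (K.X n)) (N : ℤ) [K.IsStrictlyLE N] (hN : (Fintype.card ι : ℤ) ≤ N + 1)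

include H hUa hL ψ hK hN in
/-- **`H^b_mkQ(K• ⊗_{Γ(B)} Γ(B')) ≃ₗ H^b_mkQ(Č•(k⁻¹𝓤, k^*G))`** for a flat model `ψ : K• ⥲ Č•(𝓤, G)` (bounded above, flat terms) of the Čech complex
of a finite locally free `G` on a FLAT `g : X → B` (affine base, cover with affine non-empty finite intersections) and a cartesian square over the
affine `j : B' → B`: `ψ ⊗ Γ(B')` stays a quasi-isomorphism (★ `quasiIso_extendScalars_map_of_flat`, the Čech terms being flat, ★ `flat_secMod_of_flat`),
`Č•(𝓤, G) ⊗ Γ(B') ≅ Č•(k⁻¹𝓤, k^*G)` (★ `nonempty_extendScalars_cechComplex_iso_of_isPullback`), and the map-`mkQ` cohomology is a quasi-iso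
invariant (★ `nonempty_HmkQ_linearEquiv_of_quasiIsoAt`) read in the `baseChangeComplex` model (★ `nonempty_HmkQ_extendScalars_linearEquiv_baseChangeComplex`).
[cite: MumfordAV1970, §5 Lemma 2 (p. 49)] [cite: GortzWedhorn2023, Prop. 22.90 (p. 277)] -/
theorem nonempty_HmkQ_baseChangeComplex_linearEquiv_of_isPullback (a b c : ℤ) (hab : a + 1 = b) (hbc : b + 1 = c) :
    letI := (j.appLE ⊤ ⊤ le_top).hom.toAlgebra
    Nonempty (↥((LinearMap.ker ((baseChangeComplex Γ(B', ⊤) K).d b c).hom).map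
        (LinearMap.range ((baseChangeComplex Γ(B', ⊤) K).d a b).hom).mkQ) ≃ₗ[Γ(B', ⊤)]
      ↥((LinearMap.ker ((cechComplex (fun i => k ⁻¹ᵁ U i) ((Scheme.Modules.pullback k).obj G) g'.appTop.hom).d b c).hom).map
        (LinearMap.range ((cechComplex (fun i => k ⁻¹ᵁ U i) ((Scheme.Modules.pullback k).obj G) g'.appTop.hom).d a b).hom).mkQ)) := by
  letI := (j.appLE ⊤ ⊤ le_top).hom.toAlgebra
  -- the Čech terms are flat over `Γ(B)` and the Čech complex is bounded above by `N`
  have hflatC : ∀ n, Module.Flat Γ(B, ⊤) ((cechComplex U G g.appTop.hom).X n) :=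
    flat_cechComplex_X U G _ (flat_secMod_of_flat g U hUa G hL)
  haveI : (cechComplex U G g.appTop.hom).IsStrictlyLE N := isStrictlyLE_cechComplex U G _ N hN
  -- `ψ ⊗ Γ(B')` is a quasi-isomorphism (Mumford §5 Lemma 2)
  haveI hq : QuasiIso (((ModuleCat.extendScalars (j.appLE ⊤ ⊤ le_top).hom).mapHomologicalComplex (ComplexShape.up ℤ)).map ψ) :=
    quasiIso_extendScalars_map_of_flat (j.appLE ⊤ ⊤ le_top).hom ψ hK hflatC N
  -- affine base change of the Čech complex
  have hG : IsAffineLocalizing G := by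
    haveI := hL.isVectorBundle.1
    exact IsAffineLocalizing.of_isQuasicoherent G
  obtain ⟨Φ⟩ := nonempty_extendScalars_cechComplex_iso_of_isPullback H U hUa G hG
  haveI : QuasiIso ((((ModuleCat.extendScalars (j.appLE ⊤ ⊤ le_top).hom).mapHomologicalComplex (ComplexShape.up ℤ)).map ψ) ≫ Φ.hom) :=
    quasiIso_comp _ _
  obtain ⟨e₁⟩ := nonempty_HmkQ_extendScalars_linearEquiv_baseChangeComplex (j.appLE ⊤ ⊤ le_top).hom K a b c
  obtain ⟨e₂⟩ := nonempty_HmkQ_linearEquiv_of_quasiIsoAt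
    ((((ModuleCat.extendScalars (j.appLE ⊤ ⊤ le_top).hom).mapHomologicalComplex (ComplexShape.up ℤ)).map ψ) ≫ Φ.hom) a b c hab hbc
  exact ⟨e₁.symm.trans e₂⟩

include H hUa hL ψ hK hN in
/-- **`finrank_{Γ(B')} H^b_mkQ(K• ⊗_{Γ(B)} Γ(B')) = finrank_{Γ(B')} H^b_mkQ(Č•(k⁻¹𝓤, k^*G))`** — the cohomology counts of the Grothendieck complex after
the affine base change `j : B' → B` are the Čech counts of the pulled-back bundle on `X' = X ×_B B'` (Mumford §5 Cor. 2, any degree).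
[cite: MumfordAV1970, §5 Lemma 2 (p. 49)] [cite: GortzWedhorn2023, Cor. 23.135 (p. 355)] -/
theorem finrank_HmkQ_baseChangeComplex_eq_of_isPullback (a b c : ℤ) (hab : a + 1 = b) (hbc : b + 1 = c) :
    letI := (j.appLE ⊤ ⊤ le_top).hom.toAlgebra
    Module.finrank Γ(B', ⊤) ↥((LinearMap.ker ((baseChangeComplex Γ(B', ⊤) K).d b c).hom).map
        (LinearMap.range ((baseChangeComplex Γ(B', ⊤) K).d a b).hom).mkQ) =
      Module.finrank Γ(B', ⊤) ↥((LinearMap.ker ((cechComplex (fun i => k ⁻¹ᵁ U i) ((Scheme.Modules.pullback k).obj G) g'.appTop.hom).d b c).hom).map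
        (LinearMap.range ((cechComplex (fun i => k ⁻¹ᵁ U i) ((Scheme.Modules.pullback k).obj G) g'.appTop.hom).d a b).hom).mkQ) := by
  letI := (j.appLE ⊤ ⊤ le_top).hom.toAlgebra
  obtain ⟨e⟩ := nonempty_HmkQ_baseChangeComplex_linearEquiv_of_isPullback H U hUa hL ψ hK N hN a b c hab hbc
  exact e.finrank_eq

end Literature.AlgebraicGeometry.Modules

end
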